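import Literature.Computability.AlgebraicComplexity.GeneralisedGrenetMatrix
import HarnessLib

/-!
# The graded normal form of a pencil with adapted bases (equality in LR17 Thm. 2.8)

Topic `Literature/Computability/AlgebraicComplexity`.  Companion of `GeneralisedGrenetMatrix.lean`
(entries of the generalised Grenet matrix `G(a, e)`: Grenet's `(univ, ∅)` minor of `1 - M`,
reindexed along `e : Finset (Fin N) ≃ Fin (m + 1)`, sign `(-1)^(e univ + e ∅)`, for the
arc-weighted adjacency matrix `M` of the subset lattice whose arc `S → insert k S` carries the
linear form `∑_c a S k c · x_{k,c}`) and of `LREqualityWeights.lean` (adapted bases of a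
left-equivariant pencil at equality in Landsberg–Ressayre's Thm. 2.8).

* `LRPencil.genRepr_eq_of_adapted_bases` — **graded normal form**: if the pencil
  `Ã = Λ + ∑ x_{pq} A_{pq}` of an affine `m × m` matrix `A` (`N ≥ 1`) admits ADAPTED BASES
  `f_S` (`S ≠ univ`) and `g_T` (`T ≠ ∅`) of `Kᵐ` — `Λ f_S = g_S` (`∅ ≠ S ≠ univ`), `Λ f_∅ = 0`,
  `A_{pq} f_S ∈ K g_{S ∪ {p}}` (`p ∉ S`), `A_{pq} f_S = 0` (`p ∈ S`), as produced by
  `LRPencil.TorusData.exists_adapted_bases` — then `G(a, e) = P · Aᵀ · Q` for some `a` and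
  constant invertible `P, Q` with `det P · det Q = 1` (so `det G(a, e) = det A`): the matrix of the
  pencil in the adapted bases is the transpose of a generalised Grenet matrix, and the scalar
  `det P · det Q` is absorbed into the forms on the arcs leaving `∅`.

## References

* J. M. Landsberg, N. Ressayre, *Permanent v. determinant: an exponential lower bound assuming
  symmetry and a potential path towards Valiant's conjecture*, Differential Geom. Appl. 55 (2017)
  146–166, arXiv:1508.05788, §2.2 (Grenet's graded representation) and §6 (proof of Thm. 2.8)
  (key `LandsbergRessayre2017`).
* B. Grenet, *An upper bound for the permanent versus determinant problem* (2011), Thm. 1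
  (key `Grenet2011`).
-/

noncomputable section

open Matrix MvPolynomial Finset

namespace Literature.Computability.AlgebraicComplexity

namespace LRPencil

open Grenet

variable {K : Type*} [Field K] {N m : ℕ}

/-- **Graded normal form.**  Let `A` be an `m × m` matrix of affine polynomials in the `x_{pq}`
(`p, q ∈ [N]`, `N ≥ 1`) whose pencil `Λ = Ã(0)`, `A_{pq}` admits ADAPTED BASES along a labelling
`e : Finset (Fin N) ≃ Fin (m + 1)`: vectors `f_S` (`S ≠ univ`, linearly independent) and `g_T`
(`T ≠ ∅`, linearly independent) of `Kᵐ` with `Λ f_S = g_S` for `∅ ≠ S ≠ univ`, `Λ f_∅ = 0`,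
`A_{pq} f_S ∈ K · g_{S ∪ {p}}` for `p ∉ S` and `A_{pq} f_S = 0` for `p ∈ S`.  Then the generalised
Grenet matrix `G(a, e)` equals `P · Aᵀ · Q` for some arc coefficients `a` and constant invertible
`P, Q` with `det P · det Q = 1`: in the adapted bases the pencil IS the transpose of a generalised
Grenet matrix (up to the sign and the labelling), and the scalar `det P det Q` is absorbed into the
forms on the arcs leaving `∅`.  This is the shape of Grenet's representation (LR17 §2.2) reached in
the equality case of LR17 Thm. 2.8 (§6). [cite: LandsbergRessayre2017, §6] -/
theorem genRepr_eq_of_adapted_bases (hN : 1 ≤ N) (e : Finset (Fin N) ≃ Fin (m + 1))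
    {A : Matrix (Fin m) (Fin m) (MvPolynomial (Fin N × Fin N) K)}
    (haff : ∀ r c, (A r c).totalDegree ≤ 1) {f g : Finset (Fin N) → (Fin m → K)}
    (hf : LinearIndependent K (fun S : {S : Finset (Fin N) // S ≠ univ} => f S))
    (hg : LinearIndependent K (fun T : {T : Finset (Fin N) // T ≠ ∅} => g T))
    (hΛ : ∀ S, S ≠ ∅ → S ≠ univ → constPart A *ᵥ f S = g S) (hΛ0 : constPart A *ᵥ f ∅ = 0)
    (hA : ∀ (S : Finset (Fin N)) (p q : Fin N), p ∉ S →
      ∃ t : K, coeffMat A (p, q) *ᵥ f S = t • g (insert p S))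
    (hA' : ∀ (S : Finset (Fin N)) (p q : Fin N), p ∈ S → coeffMat A (p, q) *ᵥ f S = 0) :
    ∃ (a : Finset (Fin N) → Fin N → Fin N → K) (P Q : GL (Fin m) K),
      (-1 : MvPolynomial (Fin N × Fin N) K) ^ ((e Finset.univ : ℕ) + (e ∅ : ℕ)) •
          (((1 - Matrix.of fun S T : Finset (Fin N) =>
              ∑ k : Fin N, if k ∉ S ∧ T = insert k S
                then ∑ c : Fin N, a S k c • (X (k, c) : MvPolynomial (Fin N × Fin N) K)
                else 0).submatrix e.symm e.symm).submatrix
            (Fin.succAbove (e Finset.univ)) (Fin.succAbove (e ∅))) =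
        (P : Matrix (Fin m) (Fin m) K).map C * Aᵀ * (Q : Matrix (Fin m) (Fin m) K).map C ∧
      (P : Matrix (Fin m) (Fin m) K).det * (Q : Matrix (Fin m) (Fin m) K).det = 1 := by
  classical
  choose! t ht using hA
  -- the generalised Grenet matrix as a function of the arc coefficients, and its entries
  set s : ℕ := (e univ : ℕ) + (e ∅ : ℕ) with hs
  set R : (Finset (Fin N) → Fin N → Fin N → K) → Matrix (Fin m) (Fin m) (MvPolynomial (Fin N × Fin N) K) :=
    fun a => (-1 : MvPolynomial (Fin N × Fin N) K) ^ s •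
      (((1 - Matrix.of fun S T : Finset (Fin N) =>
          ∑ k : Fin N, if k ∉ S ∧ T = insert k S
            then ∑ c : Fin N, a S k c • (X (k, c) : MvPolynomial (Fin N × Fin N) K)
            else 0).submatrix e.symm e.symm).submatrix
        (Fin.succAbove (e Finset.univ)) (Fin.succAbove (e ∅))) with hR
  have hMa : ∀ (a : Finset (Fin N) → Fin N → Fin N → K) (S T : Finset (Fin N)),
      (Matrix.of fun S T : Finset (Fin N) => ∑ k : Fin N, if k ∉ S ∧ T = insert k S
        then ∑ c : Fin N, a S k c • (X (k, c) : MvPolynomial (Fin N × Fin N) K) else 0) S T =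
      ∑ k : Fin N, if k ∉ S ∧ T = insert k S
        then ∑ c : Fin N, a S k c • (X (k, c) : MvPolynomial (Fin N × Fin N) K) else 0 :=
    fun a S T => rfl
  have hRc : ∀ a i j, constantCoeff (R a i j) =
      (-1 : K) ^ s * (if e.symm ((e univ).succAbove i) = e.symm ((e ∅).succAbove j) then 1 else 0) := by
    intro a i j
    simp only [hR, Matrix.smul_apply, Matrix.submatrix_apply, smul_eq_mul]
    rw [neg_one_pow_eq_C, map_mul, constantCoeff_C, constantCoeff_one_sub_arc (hMa a)]
  have hRx : ∀ a i j (p q : Fin N), coeff (Finsupp.single (p, q) 1) (R a i j) =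
      -((-1 : K) ^ s * (if p ∉ e.symm ((e univ).succAbove i) ∧
        e.symm ((e ∅).succAbove j) = insert p (e.symm ((e univ).succAbove i))
        then a (e.symm ((e univ).succAbove i)) p q else 0)) := by
    intro a i j p q
    simp only [hR, Matrix.smul_apply, Matrix.submatrix_apply, smul_eq_mul]
    rw [neg_one_pow_eq_C, coeff_C_mul, coeff_one_sub_arc (hMa a), mul_neg]
  have hRaff : ∀ a i j, (R a i j).totalDegree ≤ 1 := by
    intro a i j
    simp only [hR, Matrix.smul_apply, Matrix.submatrix_apply, smul_eq_mul]
    exact totalDegree_neg_one_pow_mul_one_sub_arc_le (hMa a) s _ _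
  -- the base-change matrices: rows are the adapted basis vectors
  set Fm : Matrix (Fin m) (Fin m) K := Matrix.of fun i r => f (e.symm ((e univ).succAbove i)) r with hFm
  set Gm : Matrix (Fin m) (Fin m) K := Matrix.of fun j r => g (e.symm ((e ∅).succAbove j)) r with hGm
  have hFu : IsUnit Fm := by
    rw [← Matrix.linearIndependent_rows_iff_isUnit]
    exact hf.comp (fun i => ⟨e.symm ((e univ).succAbove i), rowSet_ne_univ e i⟩)
      fun i j h => rowSet_injective e (congrArg Subtype.val h)
  have hGu : IsUnit Gm := by
    rw [← Matrix.linearIndependent_rows_iff_isUnit]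
    exact hg.comp (fun j => ⟨e.symm ((e ∅).succAbove j), colSet_ne_empty e j⟩)
      fun i j h => colSet_injective e (congrArg Subtype.val h)
  obtain ⟨Gu, hGu'⟩ := hGu
  set P₀ : Matrix (Fin m) (Fin m) K := ((-1 : K) ^ s) • Fm with hP₀
  set a₀ : Finset (Fin N) → Fin N → Fin N → K := fun S p q => -t S p q with ha₀
  -- the identity in the adapted bases: `G(a₀, e) · Gm = P₀ · Aᵀ`
  have hmul : R a₀ * Gm.map C = P₀.map C * Aᵀ := by
    refine eq_of_constPart_eq_of_coeffMat_eq (totalDegree_mul_map_C_le (hRaff a₀) Gm)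
      (totalDegree_map_C_mul_le P₀ fun i j => haff j i) ?_ fun v => ?_
    · rw [constPart_mul, constPart_map_C, constPart_mul, constPart_map_C, constPart_transpose]
      ext i r
      rw [Matrix.mul_apply, Matrix.mul_apply]
      simp only [constPart_apply, hRc, hGm, hP₀, hFm, Matrix.of_apply, Matrix.smul_apply,
        Matrix.transpose_apply, smul_eq_mul, mul_assoc]
      rw [← Finset.mul_sum, ← Finset.mul_sum]
      congr 1
      have hmv : ∑ x, f (e.symm ((e univ).succAbove i)) x * constantCoeff (A r x) =
          (constPart A *ᵥ f (e.symm ((e univ).succAbove i))) r := by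
        rw [Matrix.mulVec, dotProduct]
        exact sum_congr rfl fun x _ => by rw [constPart_apply, mul_comm]
      rw [hmv]
      by_cases h0 : e.symm ((e univ).succAbove i) = ∅
      · rw [h0, hΛ0, Pi.zero_apply]
        exact sum_eq_zero fun j _ => by rw [if_neg (Ne.symm (colSet_ne_empty e j)), zero_mul]
      · obtain ⟨j₀, hj₀⟩ := exists_colSet_eq e h0
        rw [hΛ _ h0 (rowSet_ne_univ e i), Finset.sum_eq_single j₀]
        · rw [hj₀, if_pos rfl, one_mul]
        · intro j _ hj
          rw [if_neg (fun h => hj (colSet_injective e (h.symm.trans hj₀.symm))), zero_mul]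
        · exact fun h => absurd (mem_univ j₀) h
    · obtain ⟨p, q⟩ := v
      have hcoeff : ∀ i j, coeff (Finsupp.single (p, q) 1) (R a₀ i j) =
          (-1 : K) ^ s * (if p ∉ e.symm ((e univ).succAbove i) ∧
            e.symm ((e ∅).succAbove j) = insert p (e.symm ((e univ).succAbove i))
            then t (e.symm ((e univ).succAbove i)) p q else 0) := fun i j => by
        rw [hRx, ha₀]
        split_ifs
        · rw [mul_neg, neg_neg]
        · rw [mul_zero, neg_zero]
      rw [coeffMat_mul_map_C, coeffMat_map_C_mul, coeffMat_transpose]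
      ext i r
      rw [Matrix.mul_apply, Matrix.mul_apply]
      simp only [coeffMat_apply, hcoeff, hGm, hP₀, hFm, Matrix.of_apply, Matrix.smul_apply,
        Matrix.transpose_apply, smul_eq_mul, mul_assoc]
      rw [← Finset.mul_sum, ← Finset.mul_sum]
      congr 1
      have hmv : ∑ x, f (e.symm ((e univ).succAbove i)) x * coeff (Finsupp.single (p, q) 1) (A r x) =
          (coeffMat A (p, q) *ᵥ f (e.symm ((e univ).succAbove i))) r := by
        rw [Matrix.mulVec, dotProduct]
        exact sum_congr rfl fun x _ => by rw [coeffMat_apply, mul_comm]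
      rw [hmv]
      by_cases hp : p ∈ e.symm ((e univ).succAbove i)
      · rw [hA' _ p q hp, Pi.zero_apply]
        refine sum_eq_zero fun j _ => ?_
        rw [if_neg (fun h => h.1 hp)]
        simp
      · obtain ⟨j₀, hj₀⟩ := exists_colSet_eq e (insert_ne_empty p (e.symm ((e univ).succAbove i)))
        rw [ht _ p q hp, Finset.sum_eq_single j₀]
        · rw [hj₀, if_pos ⟨hp, rfl⟩, Pi.smul_apply, smul_eq_mul]
        · intro j _ hj
          rw [if_neg (fun h => hj (colSet_injective e (h.2.trans hj₀.symm)))]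
          simp
        · exact fun h => absurd (mem_univ j₀) h
  have key : R a₀ = P₀.map C * Aᵀ * ((Gu⁻¹ : (Matrix (Fin m) (Fin m) K)ˣ) : Matrix (Fin m) (Fin m) K).map C := by
    rw [← hmul, Matrix.mul_assoc, ← Matrix.map_mul, ← hGu', ← Units.val_mul, mul_inv_cancel,
      Units.val_one, Matrix.map_one C C_0 C_1, Matrix.mul_one]
  -- normalisation of the determinant through the row of `∅`
  have hP₀u : IsUnit P₀ := by
    rw [Matrix.isUnit_iff_isUnit_det, hP₀, Matrix.det_smul]
    exact (((isUnit_one.neg).pow _).pow _).mul ((Matrix.isUnit_iff_isUnit_det _).1 hFu)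
  set c : K := P₀.det * ((Gu⁻¹ : (Matrix (Fin m) (Fin m) K)ˣ) : Matrix (Fin m) (Fin m) K).det with hc
  have hcu : IsUnit c :=
    ((Matrix.isUnit_iff_isUnit_det _).1 hP₀u).mul (Matrix.isUnits_det_units _)
  have hc0 : c ≠ 0 := hcu.ne_zero
  obtain ⟨i₀, hi₀⟩ := exists_rowSet_eq e (S := ∅)
    (fun h => Finset.univ_eq_empty_iff.1 h.symm |>.false ⟨0, hN⟩)
  set d : Fin m → K := fun i => if i = i₀ then c⁻¹ else 1 with hd
  have hdu : IsUnit (Matrix.diagonal d) := by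
    rw [Matrix.isUnit_iff_isUnit_det, Matrix.det_diagonal]
    exact IsUnit.prod_univ_iff.2 fun i => by
      by_cases hi : i = i₀
      · rw [hd]; simp only [hi, if_true]; exact (IsUnit.mk0 c hc0).inv
      · rw [hd]; simp only [hi, if_false]; exact isUnit_one
  have hdiag : (Matrix.diagonal fun i => if i = i₀ then C c⁻¹ else (1 : MvPolynomial (Fin N × Fin N) K)) =
      (Matrix.diagonal d).map C := by
    rw [Matrix.diagonal_map (map_zero C)]
    congr 1
    funext i
    simp only [hd, apply_ite C, map_one]
  set a₁ : Finset (Fin N) → Fin N → Fin N → K :=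
    fun S p q => if S = ∅ then c⁻¹ * a₀ S p q else a₀ S p q with ha₁
  have hscale : R a₁ = (Matrix.diagonal fun i => if i = i₀ then C c⁻¹ else 1) * R a₀ := by
    ext i j
    rw [Matrix.diagonal_mul]
    simp only [hR, Matrix.smul_apply, Matrix.submatrix_apply, smul_eq_mul]
    rw [one_sub_arc_scale_root (hMa a₀) c⁻¹ (hMa a₁) _ _ (colSet_ne_empty e j)]
    have hif : (if e.symm ((e univ).succAbove i) = ∅ then C c⁻¹ else (1 : MvPolynomial (Fin N × Fin N) K)) =
        if i = i₀ then C c⁻¹ else 1 := by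
      by_cases hi : i = i₀
      · subst hi
        rw [if_pos hi₀, if_pos rfl]
      · rw [if_neg hi, if_neg fun h => hi (rowSet_injective e (h.trans hi₀.symm))]
    rw [hif]
    ring
  refine ⟨a₁, (hdu.mul hP₀u).unit, Gu⁻¹, ?_, ?_⟩
  · show R a₁ = _
    rw [hscale, key, IsUnit.unit_spec, Matrix.map_mul, hdiag]
    simp only [Matrix.mul_assoc]
  · rw [IsUnit.unit_spec, Matrix.det_mul, mul_assoc, ← hc, Matrix.det_diagonal]
    have hprod : ∏ i, d i = c⁻¹ := by
      simp only [hd]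
      exact Finset.prod_ite_eq_of_mem' _ _ (fun _ => c⁻¹) (mem_univ _)
    rw [hprod, inv_mul_cancel₀ hc0]

end LRPencil

end Literature.Computability.AlgebraicComplexity
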